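import Summits.CriticalPhenomena.PercolationContinuityZ3.Theorems.Transplant.BoxProdZ2ConcFaceStep
import Summits.CriticalPhenomena.PercolationContinuityZ3.Theorems.Transplant.BoxProdZ2ConcKits
import Summits.CriticalPhenomena.PercolationContinuityZ3.Theorems.Transplant.KNCells2KitResidues
import Summits.CriticalPhenomena.PercolationContinuityZ3.Theorems.Transplant.KNCellsBoxProdZ2ChainT
import HarnessLib

/-!
# The FACE OBLIGATION `FaceOblAt` of the concentric `X □ ℤ²` instance (design (D), §11 v2; residue (F)): the tube step of `cond_j` —
# tube `B_X(w₀, R)`, `R = rE_{a'}(x, du)`; levels = enlargements of the face row `F^{j+1}`; region `B(w₀, R) × farA`; true target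
# `B(w₀, Rt) × M(x + du)`, `Rt = rM_{a'}(x + du)`; rim `(B(w₀,R) \ B(w₀, Rt - L')) × farA` — assembled from the kit clause (`kitClauseQ`
# with the rim/deep dichotomy; the deep route is the hypothesis `hroute`, p2-g2's elongated advance chain), the subbox / entrance / excess
# facts of `BoxProdZ2ConcFaceStep`, and the planar facts of `BoxProdZ2ConcFaceRegion`

builds on p205010 (kernel theorem, internal audit signed; external expert review pending) — nothing in this file uses p205010.
Lane `prim-bschramm`, seat `prim-bschramm-p3` (residue (F) of V56); helper file (`--supports stmt-CriticalPhenomena-4575 --as helper`).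

* `faceStep` — the `TubeStepData` of `cond_j`; `faceStep_hwide`, `faceStep_level_subset`;
* **`hkits_face`** — the per-level kit clause of the face step (levels `j' ∈ [M+1, Rlev]`), deep contacts delegated to `hroute`;
* **`faceOblAt_concG`** — `KSchA.FaceOblAt X (concSchemeG X C w₀ Λ q δc) (faceDataCG X C w₀ Λ) Δ' δ₂ h e a a' du j o`.
[cite: KozmaNitzan2024, §4 p. 27 ((30)), p. 30 (Step III), Lemma 10 (pp. 17–21), Lemma 12 (p. 24)]
-/

noncomputable section

open MeasureTheory

namespace Summit.CriticalPhenomena.PercolationContinuityZ3.Theorems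

namespace Transplant

namespace BoxProdZ2

open Literature.Probability.Percolation Literature.Probability.LatticeModels SimpleGraph KNLevels KNCells GadgetSystem Contour
open Literature.Probability.Percolation.KozmaNitzan
open Literature.Probability.Percolation.KozmaNitzan.Cells (oth oth_ne sgOf sgOf_sign eq_oth_of_ne)
open Literature.Probability.Percolation.GM
open Literature.Barriers.CriticalPhenomena (graphBall graphBall_finite mem_graphBall_self graphBall_mono)
open scoped Classical

variable {W : Type} [DecidableEq W] [Countable W] (X : SimpleGraph W) [X.LocallyFinite]
variable (C : PCells) (w₀ : W) (Λ : ConcRadiiG)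

/-! ## §1 The tube step of `cond_j` -/

/-- **The tube step of the face `(x, du, j)` at anchor `a'`**: tube `B(w₀, rE)`, source box = the face row `F^{j+1}`, region `farA`,
target `B(w₀, rM) × M(x+du) ∪ rim`, levels `[M+1, Rlev]`, source `(w₀, 0)`. [cite: KozmaNitzan2024, §4 p. 30 (Step III)] -/
def faceStep (a' : ℕ) (x : Site 2) (du : MDir) (j Rlev N M L' : ℕ) (Sfin : Finset (W × Site 2)) : TubeStepData W where
  π := ballFin X w₀ (Λ.rE a' x du)
  lo := sLo du.1 (sgOf du) (C.cen x) (5 * C.r + 10 * C.s * (j + 1 : ℕ)) (5 * C.r + 10 * C.s * (j + 1 : ℕ)) (2 * C.r)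
  hi := sHi du.1 (sgOf du) (C.cen x) (5 * C.r + 10 * C.s * (j + 1 : ℕ)) (5 * C.r + 10 * C.s * (j + 1 : ℕ)) (2 * C.r)
  Dpl := C.farA x du j
  T := ballFin X w₀ (Λ.rM a' (x + stepVec du)) ×ˢ C.M (x + stepVec du) ∪
    (ballFin X w₀ (Λ.rE a' x du) \ ballFin X w₀ (Λ.rM a' (x + stepVec du) - L')) ×ˢ C.farA x du j
  Rlev := Rlev
  N := N
  j₀ := M + 1
  j₁ := Rlev
  root := (w₀, 0)
  Sfin := Sfin

omit [Countable W] in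
/-- **The level boxes of the face step are wide** from level `M + 1` on (the face row has extent `0` along the axis).
[cite: KozmaNitzan2024, §4 p. 19 (windows)] -/
theorem faceStep_hwide {x : Site 2} {du : MDir} {j M j' : ℕ} (hj' : M + 1 ≤ j') :
    ∀ k, (sLo du.1 (sgOf du) (C.cen x) (5 * C.r + 10 * C.s * (j + 1 : ℕ)) (5 * C.r + 10 * C.s * (j + 1 : ℕ)) (2 * C.r) - ((j' : ℕ) : Site 2)) k +
      2 * M + 2 ≤ (sHi du.1 (sgOf du) (C.cen x) (5 * C.r + 10 * C.s * (j + 1 : ℕ)) (5 * C.r + 10 * C.s * (j + 1 : ℕ)) (2 * C.r) + ((j' : ℕ) : Site 2)) k := by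
  intro k
  have hj'' : (M : ℤ) + 1 ≤ j' := by exact_mod_cast hj'
  simp only [Pi.sub_apply, Pi.add_apply, Pi.natCast_apply, sLo, sHi]
  by_cases hk : k = du.1
  · subst hk; simp only [if_true]
    split_ifs <;> omega
  · simp only [hk, if_false]; have := C.one_le_r; omega

omit [DecidableEq W] [Countable W] in
/-- The levels `j' ≤ Rlev` of the face step lie in `B(w₀, R) × farA` (`Rlev + 2 ≤ 10 s`, `Rlev ≤ 3 r`, `j + 1 ≤ K`). [folklore] -/
theorem faceStep_level_subset {x : Site 2} {du : MDir} {j Rlev j' : ℕ} (hjK : j + 1 ≤ C.K) (hRlev : Rlev + 2 ≤ 10 * C.s)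
    (hRlev' : Rlev ≤ 3 * C.r) (hj' : j' ≤ Rlev) (π : Finset W) :
    tubeLevel π (sLo du.1 (sgOf du) (C.cen x) (5 * C.r + 10 * C.s * (j + 1 : ℕ)) (5 * C.r + 10 * C.s * (j + 1 : ℕ)) (2 * C.r))
      (sHi du.1 (sgOf du) (C.cen x) (5 * C.r + 10 * C.s * (j + 1 : ℕ)) (5 * C.r + 10 * C.s * (j + 1 : ℕ)) (2 * C.r)) j' ⊆ π ×ˢ C.farA x du j := by
  rw [tubeLevel]
  exact Finset.product_subset_product le_rfl (C.Face_enlarge_subset_farA x du hjK (by omega) (by omega))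

/-! ## §2 The kit clause of the face step -/

variable {C w₀ Λ}
variable (hΛ : Λ.WF C) {q : unitInterval} {δc : ℝ} {h : ProbeHistory (W × Site 2)} {e : Site 2 × MDir}
variable (hV : (concSchemeG X C w₀ Λ q δc).Valid₂ (X □ zdGraph 2) h e) {a a' : ℕ} {du : MDir}
variable (hdu : du ∈ (concSchemeG X C w₀ Λ q δc).onward (X □ zdGraph 2) h (tgt e)) {j : ℕ} {o : Finset (Sym2 (W × Site 2))}
include hΛ hV hdu

omit [Countable W] in
/-- The region `B(w₀, R) × farA` of the face step is a subbox of `Wt`. [cite: KozmaNitzan2024, §4 p. 31] -/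
theorem isSubbox_faceRg :
    IsSubbox (tubeGraph X (ballFin X w₀ (Λ.rE a' (tgt e) du))) ((concSchemeG X C w₀ Λ q δc).Wt (X □ zdGraph 2) h e a a' du j o) q
      (ballFin X w₀ (Λ.rE a' (tgt e) du) ×ˢ C.farA (tgt e) du j) :=
  isSubbox_Wt_face X hΛ hV hdu (Finset.product_subset_product le_rfl (C.farA_subset_Efar _ du j))
    (prod_disjoint_Stub X C w₀ Λ (C.farA_disjoint_Stub _ du j))

/-- **The per-level kit clause of the face step** (levels `j' ∈ [M+1, Rlev]`): `kitClauseQ` with rim contacts sent to the rim part of the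
target and deep contacts (`B(c, L_A) ⊆ B(w₀, Rt)`) routed by the hypothesis `hroute` (the elongated route, KN Lemma 11).
[cite: KozmaNitzan2024, §4 Lemma 10 Steps III–IV (pp. 19–21), Lemma 11 (p. 22)] -/
theorem hkits_face {Δ : ℕ} (hΔ : ∀ w, X.degree w ≤ Δ) {p₀ : unitInterval} (hT : TubeSubcritical X p₀) (V₀ : Finset W) {δ₂ : ℝ}
    (hδ₂ : 0 < δ₂) {msel : W → ℕ} {M : ℕ} (hmsel : ∀ τ ∈ V₀, msel τ ≤ M)
    (hstd : ∀ τ ∈ V₀,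
      1 - δ₂ ^ 2 < (bondPercolation (X □ zdGraph 2) q).real (UniqZone.zone (X □ zdGraph 2) (ufatSeq X hT V₀ τ) (msel τ) M) ∧
      ∀ g : HOct 2, 1 - δ₂ ^ 2 < (bondPercolation (X □ zdGraph 2) q).real
        (linkIn (↑(ufatSeq X hT V₀ τ M)) (ufatSeq X hT V₀ τ (msel τ)) (ballFin X τ (ufatRadius X hT V₀ M) ×ˢ piece g M)))
    (hjK : j + 1 ≤ C.K) {L_A L' Rlev kk N : ℕ} (hnF : ufatRadius X hT V₀ M ≤ Λ.rE a' (tgt e) du)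
    (hL : L_A + ufatRadius X hT V₀ M ≤ L') (hLR : L' ≤ Λ.rM a' (tgt e + stepVec du)) (hRlev : Rlev + 2 ≤ 10 * C.s) (hRlev' : Rlev ≤ 3 * C.r)
    (hN : kk * kitB Δ M (ufatRadius X hT V₀ M) ≤ N) (hk : (1 - (q : ℝ) ^ kitSB Δ M (ufatRadius X hT V₀ M)) ^ kk ≤ δ₂) (Sfin : Finset (W × Site 2))
    (hroute : ∀ j', M + 1 ≤ j' → j' ≤ Rlev → ∀ x' ∈ outerBoundary (tubeGraph X (faceStep X C w₀ Λ a' (tgt e) du j Rlev N M L' Sfin).π)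
        (tubeLevel (faceStep X C w₀ Λ a' (tgt e) du j Rlev N M L' Sfin).π (faceStep X C w₀ Λ a' (tgt e) du j Rlev N M L' Sfin).lo
          (faceStep X C w₀ Λ a' (tgt e) du j Rlev N M L' Sfin).hi j'),
      ballFin X (fibCtrT X w₀ (Λ.rE a' (tgt e) du) (ufatRadius X hT V₀ M) x'.1) L_A ⊆ ballFin X w₀ (Λ.rM a' (tgt e + stepVec du)) →
      ∃ (γ : X ≃g X) (Qt Ft : Finset (W × Site 2)), γ (fibCtrT X w₀ (Λ.rE a' (tgt e) du) (ufatRadius X hT V₀ M) x'.1) ∈ V₀ ∧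
        Ft ⊆ (faceStep X C w₀ Λ a' (tgt e) du j Rlev N M L' Sfin).T ∧ Qt ⊆ (faceStep X C w₀ Λ a' (tgt e) du j Rlev N M L' Sfin).Rg ∧
        Disjoint Ft (kitCube X w₀ (Λ.rE a' (tgt e) du) ((faceStep X C w₀ Λ a' (tgt e) du j Rlev N M L' Sfin).lo - ((j' : ℕ) : Site 2))
          ((faceStep X C w₀ Λ a' (tgt e) du j Rlev N M L' Sfin).hi + ((j' : ℕ) : Site 2)) M (ufatRadius X hT V₀ M) x') ∧
        1 - δ₂ ^ 2 < (prodBernoulli ((concSchemeG X C w₀ Λ q δc).Wt (X □ zdGraph 2) h e a a' du j o)).real (linkIn (↑Qt)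
          (frameSeq X hT V₀ γ (vctr ((faceStep X C w₀ Λ a' (tgt e) du j Rlev N M L' Sfin).lo - ((j' : ℕ) : Site 2))
            ((faceStep X C w₀ Λ a' (tgt e) du j Rlev N M L' Sfin).hi + ((j' : ℕ) : Site 2)) M
            (pwin ((faceStep X C w₀ Λ a' (tgt e) du j Rlev N M L' Sfin).lo - ((j' : ℕ) : Site 2))
              ((faceStep X C w₀ Λ a' (tgt e) du j Rlev N M L' Sfin).hi + ((j' : ℕ) : Site 2)) M x'.2).1
            (pwin ((faceStep X C w₀ Λ a' (tgt e) du j Rlev N M L' Sfin).lo - ((j' : ℕ) : Site 2))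
              ((faceStep X C w₀ Λ a' (tgt e) du j Rlev N M L' Sfin).hi + ((j' : ℕ) : Site 2)) M x'.2).2.1
            (pwin ((faceStep X C w₀ Λ a' (tgt e) du j Rlev N M L' Sfin).lo - ((j' : ℕ) : Site 2))
              ((faceStep X C w₀ Λ a' (tgt e) du j Rlev N M L' Sfin).hi + ((j' : ℕ) : Site 2)) M x'.2).2.2)
            (γ (fibCtrT X w₀ (Λ.rE a' (tgt e) du) (ufatRadius X hT V₀ M) x'.1))
            (msel (γ (fibCtrT X w₀ (Λ.rE a' (tgt e) du) (ufatRadius X hT V₀ M) x'.1)))) Ft)) :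
    let P := faceStep X C w₀ Λ a' (tgt e) du j Rlev N M L' Sfin
    ∀ j' ∈ Finset.Icc P.j₀ P.j₁, ∃ (σ : SData (W × Site 2)) (Sz : Finset (W × Site 2)),
      SHyp (tubeLData X P.π P.lo P.hi P.root P.Sfin) j' σ ∧ σ.N ≤ P.N ∧
      (1 - (q : ℝ) ^ σ.sB) ^ σ.k ≤ δ₂ ∧ Sz ⊆ (tubeLData X P.π P.lo P.hi P.root P.Sfin).X j' ∧ Sz ⊆ P.Rg ∧
      (∀ x ∈ σ.K, ∀ e' ∈ σ.seed x, e' ∉ wireSet (↑Sz : Set (W × Site 2))) ∧ (∀ x ∈ σ.K, σ.face x ⊆ Sz) ∧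
      (∀ x ∈ σ.K, 1 - 3 * δ₂ ≤ (prodBernoulli ((concSchemeG X C w₀ Λ q δc).Wt (X □ zdGraph 2) h e a a' du j o)).real {ω | ∃ u ∈ σ.face x,
        1 - δ₂ < (prodBernoulli (pinW ((concSchemeG X C w₀ Λ q δc).Wt (X □ zdGraph 2) h e a a' du j o) (wireSet (↑Sz : Set (W × Site 2))) ω)).real
          (⋃ t ∈ P.T, openConnIn (↑P.Rg : Set (W × Site 2)) u t)}) := by
  intro P j' hj'
  obtain ⟨hj'0, hj'1⟩ := Finset.mem_Icc.1 hj'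
  change M + 1 ≤ j' at hj'0
  change j' ≤ Rlev at hj'1
  have hwide := faceStep_hwide C (x := tgt e) (du := du) (j := j) hj'0
  have hXD : tubeLevel P.π P.lo P.hi j' ⊆ P.Rg := faceStep_level_subset C hjK hRlev hRlev' hj'1 _
  refine kitClauseQ X hΔ hT V₀ hδ₂ hmsel hstd hnF hwide kk P.root P.Sfin (isSubbox_faceRg X hΛ hV hdu) hXD hN hk fun x' hx' => ?_
  rcases deep_or_far_center X (w₀ := w₀) (fibCtrT X w₀ (Λ.rE a' (tgt e) du) (ufatRadius X hT V₀ M) x'.1)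
      (Rt := Λ.rM a' (tgt e + stepVec du)) hL hLR with hdeep | hfar'
  · exact Or.inr (hroute j' hj'0 hj'1 x' hx' hdeep)
  · -- rim contact
    left
    obtain ⟨u, hu⟩ := kitFace_nonempty X (nF := ufatRadius X hT V₀ M) (M := M) hwide hx'
    refine ⟨u, hu, Finset.mem_union_right _ ?_⟩
    have huQ := kitFace_subset_kitCube (X := X) hwide hx' hu
    have hushell := kitCube_subset_shell (X := X) hwide hnF hx' huQ
    obtain ⟨hu1, hu2⟩ := Finset.mem_product.1 hushell
    have hu2' : u.2 ∈ Finset.Icc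
        (sLo du.1 (sgOf du) (C.cen (tgt e)) (5 * C.r + 10 * C.s * (j + 1 : ℕ)) (5 * C.r + 10 * C.s * (j + 1 : ℕ)) (2 * C.r) - ((j' : ℕ) : Site 2))
        (sHi du.1 (sgOf du) (C.cen (tgt e)) (5 * C.r + 10 * C.s * (j + 1 : ℕ)) (5 * C.r + 10 * C.s * (j + 1 : ℕ)) (2 * C.r) + ((j' : ℕ) : Site 2)) := by
      have h' := (Finset.mem_sdiff.1 hu2).1
      rw [mem_Icc_iff] at h' ⊢
      intro k; have := h' k; simp only [Pi.add_apply, Pi.sub_apply, Pi.one_apply] at this ⊢; constructor <;> omega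
    have huD : u.2 ∈ C.farA (tgt e) du j := by
      have h' : (u.1, u.2) ∈ P.π ×ˢ C.farA (tgt e) du j := hXD ((mem_tubeLevel_iff).2 ⟨hu1, hu2'⟩)
      exact (Finset.mem_product.1 h').2
    exact Finset.mem_product.2 ⟨Finset.mem_sdiff.2 ⟨hu1, hfar' u.1 ((mem_kitCube_iff (X := X)).1 huQ).1⟩, huD⟩

/-! ## §3 The face obligation -/

/-- **`FaceOblAt` for the concentric instance.**  For a valid history, its examined vertex `x = tgt e` at anchors `(a, a')`, an onward
`du`, a stub level `j` (`j + 1 ≤ K`) and an observation `o`: the kit machinery at the running parameter `q` (standard estimates at scale `M`,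
the counts, radii `ψ M ≤ R`, `L_A + ψ M ≤ L' ≤ Rt = rM_{a'}(x+du)`, `Rlev` levels with `M + 1 ≤ Rlev`, `Rlev + 3 ≤ 10 s`, `Rlev ≤ 3r - 1`),
the deep routes `hroute`, the entrance radii `R₀` (`rB_a(e)`, `rQ_a(x)`, the stub profile `≤ R₀`) and the excess radius `R₁ ≤ Rt - L'` at `q`
give the face obligation with `η ≤ δc / 2`. [cite: KozmaNitzan2024, §4 p. 30 (Step III), Lemma 10 (p. 17), Lemma 12 (p. 24)] -/
theorem faceOblAt_concG (hjK : j + 1 ≤ C.K) {Δ Δ' : ℕ} (hΔ : ∀ w, X.degree w ≤ Δ) {p₀ : unitInterval} (hT : TubeSubcritical X p₀)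
    (V₀ : Finset W) {δ₂ : ℝ} (hδ₂ : 0 < δ₂) {msel : W → ℕ} {M : ℕ} (hmsel : ∀ τ ∈ V₀, msel τ ≤ M)
    (hstd : ∀ τ ∈ V₀,
      1 - δ₂ ^ 2 < (bondPercolation (X □ zdGraph 2) q).real (UniqZone.zone (X □ zdGraph 2) (ufatSeq X hT V₀ τ) (msel τ) M) ∧
      ∀ g : HOct 2, 1 - δ₂ ^ 2 < (bondPercolation (X □ zdGraph 2) q).real
        (linkIn (↑(ufatSeq X hT V₀ τ M)) (ufatSeq X hT V₀ τ (msel τ)) (ballFin X τ (ufatRadius X hT V₀ M) ×ˢ piece g M)))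
    {L_A L' Rlev kk N : ℕ} (hnF : ufatRadius X hT V₀ M ≤ Λ.rE a' (tgt e) du) (hL : L_A + ufatRadius X hT V₀ M ≤ L')
    (hLR : L' ≤ Λ.rM a' (tgt e + stepVec du)) (hMR : M + 1 ≤ Rlev) (hRlev : Rlev + 3 ≤ 10 * C.s) (hRlev' : Rlev + 1 ≤ 3 * C.r)
    (hN : kk * kitB Δ M (ufatRadius X hT V₀ M) ≤ N) (hk : (1 - (q : ℝ) ^ kitSB Δ M (ufatRadius X hT V₀ M)) ^ kk ≤ δ₂)
    (hcount : 1 / (1 - (q : ℝ)) ^ (Δ' * N) ≤ δ₂ * ((Finset.Icc (M + 1) Rlev).card : ℝ))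
    (hroute : ∀ j', M + 1 ≤ j' → j' ≤ Rlev → ∀ x' ∈ outerBoundary (tubeGraph X
        (faceStep X C w₀ Λ a' (tgt e) du j Rlev N M L' ((concSchemeG X C w₀ Λ q δc).Sx (X □ zdGraph 2) h e a a' du)).π)
        (tubeLevel (faceStep X C w₀ Λ a' (tgt e) du j Rlev N M L' ((concSchemeG X C w₀ Λ q δc).Sx (X □ zdGraph 2) h e a a' du)).π
          (faceStep X C w₀ Λ a' (tgt e) du j Rlev N M L' ((concSchemeG X C w₀ Λ q δc).Sx (X □ zdGraph 2) h e a a' du)).lo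
          (faceStep X C w₀ Λ a' (tgt e) du j Rlev N M L' ((concSchemeG X C w₀ Λ q δc).Sx (X □ zdGraph 2) h e a a' du)).hi j'),
      ballFin X (fibCtrT X w₀ (Λ.rE a' (tgt e) du) (ufatRadius X hT V₀ M) x'.1) L_A ⊆ ballFin X w₀ (Λ.rM a' (tgt e + stepVec du)) →
      let P := faceStep X C w₀ Λ a' (tgt e) du j Rlev N M L' ((concSchemeG X C w₀ Λ q δc).Sx (X □ zdGraph 2) h e a a' du)
      ∃ (γ : X ≃g X) (Qt Ft : Finset (W × Site 2)), γ (fibCtrT X w₀ (Λ.rE a' (tgt e) du) (ufatRadius X hT V₀ M) x'.1) ∈ V₀ ∧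
        Ft ⊆ P.T ∧ Qt ⊆ P.Rg ∧
        Disjoint Ft (kitCube X w₀ (Λ.rE a' (tgt e) du) (P.lo - ((j' : ℕ) : Site 2)) (P.hi + ((j' : ℕ) : Site 2)) M (ufatRadius X hT V₀ M) x') ∧
        1 - δ₂ ^ 2 < (prodBernoulli ((concSchemeG X C w₀ Λ q δc).Wt (X □ zdGraph 2) h e a a' du j o)).real (linkIn (↑Qt)
          (frameSeq X hT V₀ γ (vctr (P.lo - ((j' : ℕ) : Site 2)) (P.hi + ((j' : ℕ) : Site 2)) M
            (pwin (P.lo - ((j' : ℕ) : Site 2)) (P.hi + ((j' : ℕ) : Site 2)) M x'.2).1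
            (pwin (P.lo - ((j' : ℕ) : Site 2)) (P.hi + ((j' : ℕ) : Site 2)) M x'.2).2.1
            (pwin (P.lo - ((j' : ℕ) : Site 2)) (P.hi + ((j' : ℕ) : Site 2)) M x'.2).2.2)
            (γ (fibCtrT X w₀ (Λ.rE a' (tgt e) du) (ufatRadius X hT V₀ M) x'.1))
            (msel (γ (fibCtrT X w₀ (Λ.rE a' (tgt e) du) (ufatRadius X hT V₀ M) x'.1)))) Ft))
    {R₀ : ℕ} (hB : Λ.rB a e.1 e.2 ≤ R₀) (hQ : Λ.rQ a (tgt e) ≤ R₀) (hρ : ∀ ℓ, Λ.ρ a' (tgt e) du ℓ ≤ R₀)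
    {η : ℝ} (hη : η ≤ δc / 2) {R₁ : ℕ}
    (hR₁ : ∀ R', R₁ ≤ R' → ∀ τ ∈ ({w₀} : Finset W), ∀ (Rw : ℕ) (D' A' : Finset (W × Site 2)), D' ⊆ ballFin X τ Rw ×ˢ box 2 (25 * C.r) →
      A' ⊆ D' → (∀ v ∈ A', v.1 ∈ ballFin X τ (R₀ + 1)) → (bondPercolation (X □ zdGraph 2) q).real (excess X τ R' D' A') ≤ η)
    (hR : R₁ ≤ Λ.rM a' (tgt e + stepVec du) - L') :
    KSchA.FaceOblAt X (concSchemeG X C w₀ Λ q δc) (faceDataCG X C w₀ Λ) Δ' δ₂ h e a a' du j o := by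
  set S := concSchemeG X C w₀ Λ q δc with hS
  set P := faceStep X C w₀ Λ a' (tgt e) du j Rlev N M L' (S.Sx (X □ zdGraph 2) h e a a' du) with hP
  have hRt : Λ.rM a' (tgt e + stepVec du) ≤ Λ.rE a' (tgt e) du := hΛ.ME a' (tgt e) du
  have hRgE : P.Rg ⊆ (cellGeomCG X C w₀ Λ).Efar a' (tgt e) du := Finset.product_subset_product le_rfl (C.farA_subset_Efar _ du j)
  have hRgQE : P.Rg ⊆ S.Γ.Q a (tgt e) ∪ S.Γ.Efar a' (tgt e) du := hRgE.trans Finset.subset_union_right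
  have hRgS : P.Rg ⊆ S.Sx (X □ zdGraph 2) h e a a' du := fun u hu => by
    unfold KSchA.Sx; exact Finset.mem_union_right _ (hRgE hu)
  have hTRg : P.T ⊆ P.Rg := by
    refine Finset.union_subset ?_ (Finset.product_subset_product Finset.sdiff_subset le_rfl)
    exact Finset.product_subset_product (ballFin_mono X w₀ hRt) (C.M_add_stepVec_subset_farA _ du (by omega))
  refine ⟨P, ballFin X w₀ (Λ.rM a' (tgt e + stepVec du)) ×ˢ C.M (tgt e + stepVec du), η, rfl, isSubbox_faceRg X hΛ hV hdu,
    (KSchA.finSupp_Wt (G := X □ zdGraph 2) (S := S)), hRgS, ?_, ?_, ?_, le_rfl, hTRg, ?_, hcount, ?_, Finset.subset_union_left, subset_rfl,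
    ?_, hη, ?_⟩
  · -- the planar enclosure of the levels
    exact C.Face_enlarge_subset_farA (tgt e) du hjK (by show Rlev + 1 + 2 ≤ 10 * C.s; omega) (by show Rlev + 1 ≤ 3 * C.r; omega)
  · -- the root is off the region
    exact KSchA.root_not_mem_of_fresh (levelGeomCG X C w₀ hΛ) (qSepGeomCG X C w₀ Λ) hV hdu hRgQE
  · -- the root lies in the support
    show S.Γ.root ∈ S.Sx (X □ zdGraph 2) h e a a' du
    unfold KSchA.Sx
    exact Finset.mem_union_left _ (Finset.mem_union_left _ hV.root_mem)
  · -- the target is nonempty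
    refine ⟨(w₀, C.cen (tgt e + stepVec du)), Finset.mem_union_left _ (Finset.mem_product.2 ⟨(mem_ballFin X).2 (mem_graphBall_self X _ _), ?_⟩)⟩
    show C.cen (tgt e + stepVec du) ∈ C.M (tgt e + stepVec du)
    rw [PCells.M, PCells.mem_sq_iff]; intro i; constructor <;> omega
  · -- the kit clause
    exact hkits_face X hΛ hV hdu hΔ hT V₀ hδ₂ hmsel hstd hjK hnF hL hLR (by omega) (by omega) hN hk _ hroute
  · -- the rim excess
    have hsub : P.T \ ballFin X w₀ (Λ.rM a' (tgt e + stepVec du)) ×ˢ C.M (tgt e + stepVec du) ⊆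
        (ballFin X w₀ (Λ.rE a' (tgt e) du) \ ballFin X w₀ (Λ.rM a' (tgt e + stepVec du) - L')) ×ˢ C.farA (tgt e) du j := by
      intro t ht
      obtain ⟨ht1, ht2⟩ := Finset.mem_sdiff.1 ht
      rcases Finset.mem_union.1 ht1 with h' | h'
      · exact absurd h' ht2
      · exact h'
    refine le_trans (measureReal_mono (Set.iUnion₂_subset fun t ht => ?_) (measure_ne_top _ _))
      (rim_excess_face X hΛ hV hdu (j := j) (o := o) hB hQ hρ hR₁ hR)
    exact Set.subset_biUnion_of_mem (u := fun t => openConn S.Γ.root t) (hsub ht)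
  · -- the face lies in the first level
    intro y hy
    obtain ⟨hy2, hy1⟩ := (mem_stair X).1 hy
    rw [TubeStepData.Lv_X]
    refine Finset.mem_product.2 ⟨ballFin_mono X w₀ (hΛ.ρE a' (tgt e) du _) hy1, ?_⟩
    have hy2' : y.2 ∈ Finset.Icc P.lo P.hi := hy2
    simpa using hy2'

end BoxProdZ2

end Transplant

end Summit.CriticalPhenomena.PercolationContinuityZ3.Theorems

end
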